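import Summits.ResolutionOfSingularities.ResolutionOfSingularities.Theorems.FrobeniusClosingCampaignW41Core4Lemmas
import Mathlib.Algebra.MvPolynomial.PDeriv
import Mathlib.RingTheory.AlgebraicIndependent.Basic
import Mathlib.Algebra.CharP.Lemmas
import Mathlib.Algebra.CharP.Algebra
import Mathlib.Algebra.CharP.Reduced
import Mathlib.RingTheory.Localization.AtPrime.Basic
import Mathlib.RingTheory.Valuation.ValuationSubring
import HarnessLib

/-!
# Crux `Steer` (stmt-16345), chain W4.1: the algebraic half of the trdeg-4 inhabitant of the Steer core (C1)

OURS (campaign `res-hironaka`, rung L, slot W4.1; replaces the role of no printed item; NOT a statement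
of the manuscript under review). The certificate datum of `CRUX-PLAN-Steer.md` §2 / K4.1b
(`CORE4-INHABITANT.md`): `k` perfect of characteristic `p`, `y₁, …, yₙ ∈ K` algebraically independent
over `k` (`n = 4`), `A₀ := k[y₁, …, yₙ] ⊆ O`, centre of `O` on `A₀` = the origin (`v(yₘ) > 0` for all
`m`), and the `α_p`-torsor `t ^ p = f := y₁ y₂ + y₃ ^ (p + 1)`. This file PROVES the ALGEBRAIC
hypotheses of the registered stub `stub_steerDefectCore4` (line `switching_dichotomy`) for this datum,
in the stub's own shapes:

* `pderiv_pow_char_eq_zero`, `datumPoly_not_pth_power_mul`: in `k[X]` (characteristic `p`) the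
  identity `P ^ p = (X i * X j + X l ^ (p + 1)) * S ^ p` forces `S = 0` (apply `∂/∂Xᵢ`: `p`-th powers
  are constants for derivations, so `X j * S ^ p = 0`).
* `root_not_isFracOf`: hence `t` is NOT a fraction of elements of `A₀ = k[y]` (`f` is not a `p`-th
  power in `k(y)`).
* `pow_ne_pow_of_not_isFracOf` (the Defect input `t ^ p ≠ g ^ p` of `defect_of_pDivisible`),
  `hpow_of_not_isFracOf` (hypothesis `hpow`: `t ^ p` is not a `p`-th power in the local ring of the base
  at the centre) — both from `t ∉ Frac A₀` by injectivity of Frobenius on the field `K`.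
* `hδ_of_valuation_lt_one` (hypothesis `hδ`): `t ^ p = yᵢ yⱼ + yₗ ^ (p + 1)` with all `yₘ` in the centre
  lies in `𝔪 ²` of the local ring, so no `ℤ`-derivation makes it a unit (the argument of
  `not_isUnit_derivation_of_mem_sq`, run on the stub's own `δ`, whose type carries the localization's
  `ℤ`-algebra instance).
* `core4Algebraic_of_datum`: the package `A₀.FG ∧ t ^ p ∈ A₀ ∧ hδ ∧ hpow ∧ (∀ g ∈ Frac A₀, t ^ p ≠ g ^ p)`
  for `A₀ = k[y]`.

Together with `core4Negatives_of_pDivisible` (`…Core4ValueGroup.lean`: `¬ Discrete`, `¬ DenseAbhyankar`,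
`¬ IsAbhyankarPlace`, `Defect` from the `p`-divisibility of the value group of `k(y)` and `t ∉ k(y)`),
this is the Lean half of the K4.1b certificate; the valuation itself (Kuhlmann 2004, Thm. 1.1: a
valuation of `k(y₁, …, y₄)` with value group `ℤ[1/p]` and residue field `k`), `ZeroDim`, regularity and
dimension of the centre, and `trdeg = 4` stay in the markdown certificate. No `Theses.*` / `Cruxes.*`
import (chain build rule); the stub's shapes are reproduced verbatim. All lemmas are folklore.
-/

-- layout-mandated namespace `Summit.<Summit>.<Problem>.…` with Summit = Problem (single-conjunct summit)
set_option linter.dupNamespace false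

namespace Summit.ResolutionOfSingularities.ResolutionOfSingularities.Theorems.SwitchingDichotomy

open MvPolynomial

universe u v w

/-! ## Polynomial algebra in characteristic `p` -/

/-- In characteristic `p`, partial derivatives kill `p`-th powers: `∂ᵢ (P ^ p) = p • P ^ (p-1) • ∂ᵢ P = 0`.
[folklore] -/
theorem pderiv_pow_char_eq_zero {σ : Type w} {k : Type v} [CommRing k] (p : ℕ) [CharP k p]
    (P : MvPolynomial σ k) (i : σ) : pderiv i (P ^ p) = 0 := by
  rw [Derivation.leibniz_pow, smul_eq_mul, nsmul_eq_mul, CharP.cast_eq_zero, zero_mul]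

/-- The partial derivative `∂ᵢ` of the datum polynomial `X i * X j + X l ^ (p + 1)` (`i ≠ j`, `i ≠ l`)
is `X j`. [folklore] -/
theorem pderiv_datumPoly {σ : Type w} {k : Type v} [CommRing k] (p : ℕ) {i j l : σ} (hij : i ≠ j)
    (hil : i ≠ l) :
    pderiv i (X i * X j + X l ^ (p + 1) : MvPolynomial σ k) = X j := by
  rw [map_add, pderiv_mul, pderiv_X_self, pderiv_X_of_ne hij.symm, Derivation.leibniz_pow,
    pderiv_X_of_ne hil.symm, smul_zero, smul_zero, add_zero, one_mul, mul_zero, add_zero]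

/-- **The datum polynomial is not a `p`-th power up to `p`-th powers**: over a field `k` of
characteristic `p`, `P ^ p = (X i * X j + X l ^ (p + 1)) * S ^ p` in `k[X]` (`i ≠ j`, `i ≠ l`) forces
`S = 0` — apply `∂ᵢ`: the left side and `∂ᵢ (S ^ p)` vanish, leaving `X j * S ^ p = 0`. [folklore] -/
theorem datumPoly_not_pth_power_mul {σ : Type w} {k : Type v} [Field k] (p : ℕ) [Fact p.Prime]
    [CharP k p] {i j l : σ} (hij : i ≠ j) (hil : i ≠ l) {P S : MvPolynomial σ k}
    (h : P ^ p = (X i * X j + X l ^ (p + 1)) * S ^ p) : S = 0 := by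
  have h1 := congrArg (pderiv i) h
  rw [pderiv_pow_char_eq_zero, pderiv_mul, pderiv_pow_char_eq_zero, mul_zero, add_zero,
    pderiv_datumPoly p hij hil] at h1
  rcases mul_eq_zero.mp h1.symm with h2 | h2
  · exact absurd h2 (X_ne_zero j)
  · exact pow_eq_zero_iff (Fact.out : p.Prime).ne_zero |>.mp h2

/-! ## `t ∉ Frac A₀` for the datum, and its two consequences in the stub's shapes -/

/-- **`t` is not a fraction of elements of `A₀ = k[y]`.** For `y : σ → K` algebraically independent
over `k` (characteristic `p`) and `t ^ p = y i * y j + y l ^ (p + 1)` (`i ≠ j`, `i ≠ l`), `t` is not of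
the form `a / s` with `a, s ∈ k[y]`, `s ≠ 0` (else `P ^ p = f · S ^ p` in `k[X]` for the polynomials
`P, S` of `a, s`). Equivalently: `f` is not a `p`-th power in `k(y)`. [folklore] -/
theorem root_not_isFracOf {k : Type v} {K : Type u} [Field k] [Field K] [Algebra k K] (p : ℕ)
    [Fact p.Prime] [CharP k p] {σ : Type w} (y : σ → K) (hy : AlgebraicIndependent k y)
    {i j l : σ} (hij : i ≠ j) (hil : i ≠ l) (t : K) (ht : t ^ p = y i * y j + y l ^ (p + 1)) :
    ¬ ∃ a ∈ Algebra.adjoin k (Set.range y), ∃ s ∈ Algebra.adjoin k (Set.range y),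
      s ≠ 0 ∧ t = a / s := by
  rintro ⟨a, ha, s, hs, hs0, rfl⟩
  rw [Algebra.adjoin_range_eq_range_aeval] at ha hs
  obtain ⟨P, rfl⟩ := ha
  obtain ⟨S, rfl⟩ := hs
  have hS0 : S ≠ 0 := fun h => hs0 (by rw [h, map_zero])
  rw [div_pow, div_eq_iff (pow_ne_zero _ hs0)] at ht
  have hpoly : aeval y (P ^ p) = aeval y ((X i * X j + X l ^ (p + 1)) * S ^ p) := by
    simp only [map_pow, map_mul, map_add, aeval_X]
    exact ht
  exact hS0 (datumPoly_not_pth_power_mul p hij hil (algebraicIndependent_iff_injective_aeval.mp hy hpoly))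

/-- **Defect input from `t ∉ Frac A₀`.** In characteristic `p`, if `t` is not a fraction of elements of
`A₀` then `t ^ p ≠ g ^ p` for every fraction `g` of elements of `A₀` (Frobenius is injective on the
field `K`) — hypothesis `hnp` of `defect_of_pDivisible`. [folklore] -/
theorem pow_ne_pow_of_not_isFracOf {k : Type v} {K : Type u} [Field k] [Field K] [Algebra k K]
    (p : ℕ) [Fact p.Prime] [CharP K p] (A₀ : Subalgebra k K) (t : K)
    (hnt : ¬ ∃ a ∈ A₀, ∃ s ∈ A₀, s ≠ 0 ∧ t = a / s) :
    ∀ g : K, (∃ a ∈ A₀, ∃ s ∈ A₀, s ≠ 0 ∧ g = a / s) → t ^ p ≠ g ^ p := by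
  intro g hg h
  have htg : t = g := frobenius_inj K p h
  exact hnt (htg ▸ hg)

/-- **Hypothesis `hpow` from `t ∉ Frac A₀`.** In characteristic `p`, with `A₀ ⊆ O` and `t ^ p ∈ A₀`:
if `t` is not a fraction of elements of `A₀`, then the image of `t ^ p` in the local ring of the base
at the centre of `O` (`Localization.AtPrime (𝔪_O ∩ A₀)`, verbatim as in `stub_steerDefectCore4`) is not
a `p`-th power: from `t ^ p = (a / s) ^ p` there, `t ^ p · s ^ p = a ^ p` in `A₀` (the base is a domain),
so `t = a / s` by injectivity of Frobenius on `K`. [folklore] -/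
theorem hpow_of_not_isFracOf {k : Type v} {K : Type u} [Field k] [Field K] [Algebra k K] (p : ℕ)
    [Fact p.Prime] [CharP K p] (O : ValuationSubring K) (A₀ : Subalgebra k K)
    (h₀ : A₀.toSubring ≤ O.toSubring) (t : K) (htp : t ^ p ∈ A₀)
    (hnt : ¬ ∃ a ∈ A₀, ∃ s ∈ A₀, s ≠ 0 ∧ t = a / s) :
    ∀ c : Localization.AtPrime (Ideal.comap (Subring.inclusion h₀) (IsLocalRing.maximalIdeal O)),
      algebraMap A₀.toSubring (Localization.AtPrime (Ideal.comap (Subring.inclusion h₀)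
        (IsLocalRing.maximalIdeal O))) ⟨t ^ p, htp⟩ ≠ c ^ p := by
  set 𝔭 := Ideal.comap (Subring.inclusion h₀) (IsLocalRing.maximalIdeal O) with h𝔭
  set L := Localization.AtPrime 𝔭 with hL
  intro c hc
  obtain ⟨⟨a, s⟩, rfl⟩ := IsLocalization.mk'_surjective 𝔭.primeCompl c
  change algebraMap A₀.toSubring L ⟨t ^ p, htp⟩ = IsLocalization.mk' L a s ^ p at hc
  rw [← IsLocalization.mk'_pow, ← IsLocalization.mk'_one (M := 𝔭.primeCompl) L,
    IsLocalization.mk'_eq_iff_eq] at hc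
  have hinj : Function.Injective (algebraMap A₀.toSubring L) :=
    IsLocalization.injective L 𝔭.primeCompl_le_nonZeroDivisors
  have hc' := congrArg (fun x : A₀.toSubring => (x : K)) (hinj hc)
  simp only [Subring.coe_mul, SubmonoidClass.coe_pow, OneMemClass.coe_one, one_mul] at hc'
  -- `hc' : s ^ p * t ^ p = a ^ p` in `K`
  have hs0 : ((s : A₀.toSubring) : K) ≠ 0 := fun h => by
    have hsz : (s : A₀.toSubring) = 0 := Subtype.ext h
    exact s.2 (by rw [hsz]; exact 𝔭.zero_mem)
  have hts : t = ((a : A₀.toSubring) : K) / ((s : A₀.toSubring) : K) := by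
    rw [eq_div_iff hs0]
    apply frobenius_inj K p
    simp only [frobenius_def, mul_pow]
    rw [mul_comm, hc']
  exact hnt ⟨_, (a : A₀.toSubring).2, _, (s : A₀.toSubring).2, hs0, hts⟩

/-- **Hypothesis `hδ` for the datum.** With `A₀ ⊆ O`, elements `y i, y j, y l ∈ A₀` of value `< 1`
(i.e. in the centre of `O` on `A₀`) and `t ^ p = y i * y j + y l ^ (p + 1) ∈ A₀` (`1 ≤ p`): the image
of `t ^ p` in the local ring of the base at the centre lies in `𝔪 ²`, so for every `ℤ`-derivation `δ` of
that local ring `δ (t ^ p)` is not a unit — verbatim the shape of `hδ` in `stub_steerDefectCore4`.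
(`t ^ p = y i` would fail: `∂/∂yᵢ` is a unit — the monogenic exit.) [folklore] -/
theorem hδ_of_valuation_lt_one {k : Type v} {K : Type u} [Field k] [Field K] [Algebra k K] (p : ℕ)
    (hp : 1 ≤ p) (O : ValuationSubring K) (A₀ : Subalgebra k K) (h₀ : A₀.toSubring ≤ O.toSubring)
    {yi yj yl : K} (hyi : yi ∈ A₀) (hyj : yj ∈ A₀) (hyl : yl ∈ A₀) (hvi : O.valuation yi < 1)
    (hvj : O.valuation yj < 1) (hvl : O.valuation yl < 1) (t : K) (htp : t ^ p ∈ A₀)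
    (ht : t ^ p = yi * yj + yl ^ (p + 1)) :
    ∀ δ : Derivation ℤ (Localization.AtPrime (Ideal.comap (Subring.inclusion h₀)
        (IsLocalRing.maximalIdeal O))) (Localization.AtPrime (Ideal.comap (Subring.inclusion h₀)
        (IsLocalRing.maximalIdeal O))),
      ¬ IsUnit (δ (algebraMap A₀.toSubring (Localization.AtPrime (Ideal.comap (Subring.inclusion h₀)
        (IsLocalRing.maximalIdeal O))) ⟨t ^ p, htp⟩)) := by
  set 𝔭 := Ideal.comap (Subring.inclusion h₀) (IsLocalRing.maximalIdeal O) with h𝔭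
  set L := Localization.AtPrime 𝔭 with hL
  intro δ
  -- the generators lie in the maximal ideal of `L`
  have hmem : ∀ {z : K} (hz : z ∈ A₀), O.valuation z < 1 →
      algebraMap A₀.toSubring L ⟨z, hz⟩ ∈ IsLocalRing.maximalIdeal L := fun {z} hz hv => by
    refine (IsLocalization.AtPrime.to_map_mem_maximal_iff L 𝔭 _).mpr ?_
    rw [h𝔭, Ideal.mem_comap]
    exact (ValuationSubring.valuation_lt_one_iff O _).mpr hv
  have heq : (⟨t ^ p, htp⟩ : A₀.toSubring) =
      ⟨yi, hyi⟩ * ⟨yj, hyj⟩ + ⟨yl, hyl⟩ ^ (p + 1) := Subtype.ext (by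
    simp only [Subring.coe_add, Subring.coe_mul, SubmonoidClass.coe_pow]; exact ht)
  -- `t ^ p ∈ 𝔪_L ^ 2`
  have hsq : algebraMap A₀.toSubring L ⟨t ^ p, htp⟩ ∈ (IsLocalRing.maximalIdeal L) ^ 2 := by
    rw [heq, map_add, map_mul, map_pow, pow_two]
    refine add_mem (Ideal.mul_mem_mul (hmem hyi hvi) (hmem hyj hvj)) ?_
    obtain ⟨q, hq⟩ := Nat.exists_eq_add_of_le hp
    rw [hq, show 1 + q + 1 = q + 2 by ring, pow_add, pow_two]
    exact Ideal.mul_mem_left _ _ (Ideal.mul_mem_mul (hmem hyl hvl) (hmem hyl hvl))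
  -- derivations (over any scalars) map `𝔪 ^ 2` into `𝔪`; done directly on this `δ`, whose type carries
  -- the localization's own `ℤ`-algebra instance
  have key : ∀ x ∈ (IsLocalRing.maximalIdeal L) ^ 2, δ x ∈ IsLocalRing.maximalIdeal L := by
    intro x hx
    rw [pow_two] at hx
    refine Submodule.mul_induction_on hx (fun a ha b hb => ?_) (fun x y hx hy => ?_)
    · rw [Derivation.leibniz, smul_eq_mul, smul_eq_mul]
      exact add_mem (Ideal.mul_mem_right _ _ ha) (Ideal.mul_mem_right _ _ hb)
    · rw [map_add]
      exact add_mem hx hy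
  exact (IsLocalRing.mem_maximalIdeal _).mp (key _ hsq)

/-! ## The package for `A₀ = k[y]` -/

/-- **Algebraic half of the trdeg-`n` inhabitant of the Steer core (chain W4.1, K4.1b).** Let `k` be a
field of characteristic `p`, `y : σ → K` (`σ` finite) algebraically independent over `k`,
`A₀ := k[y] ⊆ O` with every `yₘ` in the centre of `O` (`v(yₘ) < 1`), and `t ^ p = y i * y j + y l ^ (p+1)`
with `i ≠ j`, `i ≠ l`. Then, in the shapes of `stub_steerDefectCore4`: `A₀.FG`, `t ^ p ∈ A₀`, `hδ` (no
unit `ℤ`-derivative of `t ^ p` at the centre), `hpow` (`t ^ p` not a `p`-th power at the centre), and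
the Defect input `∀ g ∈ Frac A₀, t ^ p ≠ g ^ p`. OURS; replaces the role of no printed item. [folklore] -/
theorem core4Algebraic_of_datum (p : ℕ) (hp : p.Prime) {k : Type v} {K : Type u} [Field k] [CharP k p]
    [Field K] [Algebra k K] {σ : Type w} [Finite σ] (y : σ → K) (hy : AlgebraicIndependent k y)
    (O : ValuationSubring K) (h₀ : (Algebra.adjoin k (Set.range y)).toSubring ≤ O.toSubring)
    (hv : ∀ m, O.valuation (y m) < 1) {i j l : σ} (hij : i ≠ j) (hil : i ≠ l) (t : K)
    (ht : t ^ p = y i * y j + y l ^ (p + 1)) :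
    (Algebra.adjoin k (Set.range y)).FG ∧
    ∃ htp : t ^ p ∈ Algebra.adjoin k (Set.range y),
      (∀ δ : Derivation ℤ (Localization.AtPrime (Ideal.comap (Subring.inclusion h₀)
          (IsLocalRing.maximalIdeal O))) (Localization.AtPrime (Ideal.comap (Subring.inclusion h₀)
          (IsLocalRing.maximalIdeal O))),
        ¬ IsUnit (δ (algebraMap (Algebra.adjoin k (Set.range y)).toSubring (Localization.AtPrime
          (Ideal.comap (Subring.inclusion h₀) (IsLocalRing.maximalIdeal O))) ⟨t ^ p, htp⟩))) ∧
      (∀ c : Localization.AtPrime (Ideal.comap (Subring.inclusion h₀) (IsLocalRing.maximalIdeal O)),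
        algebraMap (Algebra.adjoin k (Set.range y)).toSubring (Localization.AtPrime (Ideal.comap
          (Subring.inclusion h₀) (IsLocalRing.maximalIdeal O))) ⟨t ^ p, htp⟩ ≠ c ^ p) ∧
      (∀ g : K, (∃ a ∈ Algebra.adjoin k (Set.range y), ∃ s ∈ Algebra.adjoin k (Set.range y),
        s ≠ 0 ∧ g = a / s) → t ^ p ≠ g ^ p) := by
  haveI : Fact p.Prime := ⟨hp⟩
  haveI : CharP K p := charP_of_injective_algebraMap (algebraMap k K).injective p
  set A₀ := Algebra.adjoin k (Set.range y) with hA₀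
  have hym : ∀ m, y m ∈ A₀ := fun m => Algebra.subset_adjoin ⟨m, rfl⟩
  have htp : t ^ p ∈ A₀ := by
    rw [ht]
    exact A₀.add_mem (A₀.mul_mem (hym i) (hym j)) (A₀.pow_mem (hym l) _)
  have hnt := root_not_isFracOf p y hy hij hil t ht
  refine ⟨?_, htp, hδ_of_valuation_lt_one p hp.one_lt.le O A₀ h₀ (hym i) (hym j) (hym l) (hv i)
    (hv j) (hv l) t htp ht, hpow_of_not_isFracOf p O A₀ h₀ t htp hnt,
    pow_ne_pow_of_not_isFracOf p A₀ t hnt⟩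
  exact ⟨(Set.finite_range y).toFinset, by rw [Set.Finite.coe_toFinset]⟩

end Summit.ResolutionOfSingularities.ResolutionOfSingularities.Theorems.SwitchingDichotomy
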